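import Mathlib
import Literature.Analysis.FluidPDE.RapidDecayLemmas
import Literature.Analysis.FluidPDE.EnergyUniqueness
import Literature.Analysis.FluidPDE.WholeSpaceIBPIntegrable
import Literature.Analysis.FluidPDE.KNSSRegularityPlanar
import HarnessLib

/-!
# Planar calculus for the 2-D calibration inequality, I: pointwise identities and Green's formula
  (tools for item stmt-NavierStokesRegularity-1446, `QuasipotentialCoercivity.TwoDimensionalActionBound`)

Fixed-time identities on `ℝ² = EuclideanSpace ℝ (Fin 2)` for a divergence-free field `v ∈ C²`
with Schwartz-type decay, a `C¹` field `V` with decay, and a `C²` scalar `P`: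

* `sum_inner_apply_sq_eq_zero₂` — the 2-D algebra `Σᵢ ⟪A eᵢ, A (A eᵢ)⟫ = tr(Aᵀ A²) = 0` for a
  traceless `2 × 2` matrix (`A² = −det A · I`);
* `green_sum_inner_fderiv₂` — `∫ Σᵢ ⟪∂ᵢv, ∂ᵢV⟫ = −∫ ⟪Δv, V⟫` (planar twin of the tree's
  `integral_sum_inner_fderiv_fderiv_eq_neg_integral_inner_laplacian`, `L¹` hypotheses);
* `laplacian_apply_eq_curl2₂` — `Δv = ∇⊥ω = (−∂₁ω, ∂₀ω)`, `ω = curl2 v`, for `div v = 0`;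
* `fderiv_convect_self_apply₂` — `∂ₕ((v·∇)v) = (v·∇)∂ₕv + Dv(Dv h)`.
The integral identities built on these (2-D cancellation, planar pressure identity) are in the
companion file `QuasipotentialCoercivityTwoDimensionalActionBoundCancel`.

HONEST FRAMING: elementary vector calculus for a 2-D calibration inequality about forced
classical paths; nothing here bears on Navier–Stokes regularity.

## References
* A. J. Majda, A. L. Bertozzi, *Vorticity and Incompressible Flow*, CUP (2002), §1.7–§1.8, §3.1.1.
* Z. Brzeźniak, S. Cerrai, M. Freidlin, *Quasipotential and exit time for 2D stochastic
  Navier–Stokes equations driven by space time white noise*, PTRF 162 (2015), Thm. 7.1.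
-/

noncomputable section

set_option linter.dupNamespace false

namespace Summit.NavierStokesRegularity.NavierStokesRegularity.Theorems

open Set MeasureTheory Filter Topology Function InnerProductSpace
open scoped ENNReal NNReal RealInnerProductSpace ContDiff Laplacian
open Literature.Analysis.FluidPDE

namespace TwoDimActionBound

/-! ### Pointwise planar algebra and calculus -/

/-- Coordinates of a planar vector in the standard frame: `⟪x, eᵢ⟫ = xᵢ`. [folklore] -/
theorem inner_basisFun_right₂ (x : (EuclideanSpace ℝ (Fin 2))) (i : Fin 2) : ⟪x, EuclideanSpace.basisFun (Fin 2) ℝ i⟫ = x i := by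
  rw [EuclideanSpace.basisFun_apply, EuclideanSpace.inner_single_right]
  simp

/-- Coordinates of a planar vector in the standard frame: `⟪eᵢ, x⟫ = xᵢ`. [folklore] -/
theorem inner_basisFun_left₂ (x : (EuclideanSpace ℝ (Fin 2))) (i : Fin 2) : ⟪EuclideanSpace.basisFun (Fin 2) ℝ i, x⟫ = x i := by
  rw [real_inner_comm, inner_basisFun_right₂]

/-- Entries of the standard frame of the plane. [folklore] -/
theorem basisFun_apply_same₂ (i : Fin 2) : (EuclideanSpace.basisFun (Fin 2) ℝ i : (EuclideanSpace ℝ (Fin 2))) i = 1 := by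
  simp [EuclideanSpace.basisFun_apply]

/-- Entries of the standard frame of the plane. [folklore] -/
theorem basisFun_zero_one₂ : (EuclideanSpace.basisFun (Fin 2) ℝ 0 : (EuclideanSpace ℝ (Fin 2))) 1 = 0 := by
  simp [EuclideanSpace.basisFun_apply]

/-- Entries of the standard frame of the plane. [folklore] -/
theorem basisFun_one_zero₂ : (EuclideanSpace.basisFun (Fin 2) ℝ 1 : (EuclideanSpace ℝ (Fin 2))) 0 = 0 := by
  simp [EuclideanSpace.basisFun_apply]

/-- Planar inner product in coordinates: `⟪x, y⟫ = x₀ y₀ + x₁ y₁`. [folklore] -/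
theorem inner_eq_two₂ (x y : (EuclideanSpace ℝ (Fin 2))) : ⟪x, y⟫ = x 0 * y 0 + x 1 * y 1 := by
  rw [PiLp.inner_apply, Fin.sum_univ_two]
  simp [mul_comm]

/-- Expansion of a planar vector in the standard frame: `x = x₀ e₀ + x₁ e₁`. [folklore] -/
theorem eq_sum_basisFun₂ (x : (EuclideanSpace ℝ (Fin 2))) : x = x 0 • EuclideanSpace.basisFun (Fin 2) ℝ 0 + x 1 • EuclideanSpace.basisFun (Fin 2) ℝ 1 := by
  have h := ((EuclideanSpace.basisFun (Fin 2) ℝ).sum_repr' x).symm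
  rw [Fin.sum_univ_two, inner_basisFun_left₂, inner_basisFun_left₂] at h
  exact h

/-- **The 2-D algebra behind the absence of vortex stretching**: for a traceless linear map `A`
of the plane, `Σᵢ ⟪A eᵢ, A (A eᵢ)⟫ = tr (Aᵀ A²) = 0` (Cayley–Hamilton: `A² = −det A · I`). [folklore] -/
theorem sum_inner_apply_sq_eq_zero₂ (A : (EuclideanSpace ℝ (Fin 2)) →L[ℝ] (EuclideanSpace ℝ (Fin 2))) (htr : A (EuclideanSpace.basisFun (Fin 2) ℝ 0) 0 + A (EuclideanSpace.basisFun (Fin 2) ℝ 1) 1 = 0) :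
    ∑ i, ⟪A (EuclideanSpace.basisFun (Fin 2) ℝ i), A (A (EuclideanSpace.basisFun (Fin 2) ℝ i))⟫ = 0 := by
  set a : (EuclideanSpace ℝ (Fin 2)) := A (EuclideanSpace.basisFun (Fin 2) ℝ 0) with ha
  set c : (EuclideanSpace ℝ (Fin 2)) := A (EuclideanSpace.basisFun (Fin 2) ℝ 1) with hc
  have hAa : A a = a 0 • a + a 1 • c := by
    conv_lhs => rw [eq_sum_basisFun₂ a]
    rw [map_add, map_smul, map_smul]
  have hAc : A c = c 0 • a + c 1 • c := by
    conv_lhs => rw [eq_sum_basisFun₂ c]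
    rw [map_add, map_smul, map_smul]
  rw [Fin.sum_univ_two, ← ha, ← hc, hAa, hAc]
  simp only [inner_add_right, real_inner_smul_right, inner_eq_two₂]
  linear_combination (a 1 ^ 2 + c 0 ^ 2 + a 0 ^ 2 - a 0 * c 1 + c 1 ^ 2 + a 1 * c 0) * htr

/-- The trace condition in coordinates: `div v (x) = (Dv(x) e₀)₀ + (Dv(x) e₁)₁`. [folklore] -/
theorem divergence_eq_two₂ (v : (EuclideanSpace ℝ (Fin 2)) → (EuclideanSpace ℝ (Fin 2))) (x : (EuclideanSpace ℝ (Fin 2))) :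
    VectorCalculus.divergence v x = fderiv ℝ v x (EuclideanSpace.basisFun (Fin 2) ℝ 0) 0 + fderiv ℝ v x (EuclideanSpace.basisFun (Fin 2) ℝ 1) 1 := by
  rw [divergence_eq_sum_inner_fderiv (EuclideanSpace.basisFun (Fin 2) ℝ), Fin.sum_univ_two, real_inner_comm,
    inner_basisFun_right₂, real_inner_comm, inner_basisFun_right₂]

/-- Mixed second derivatives as entries of the second Fréchet derivative:
`∂_b(∂ₐ g)(x) = D²g(x)(b)(a)` for `g` with `Dg` differentiable. [folklore] -/
theorem fderiv_apply_const_apply₂ {G : Type*} [NormedAddCommGroup G] [NormedSpace ℝ G]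
    {g : (EuclideanSpace ℝ (Fin 2)) → G} {x : (EuclideanSpace ℝ (Fin 2))} (hg : DifferentiableAt ℝ (fderiv ℝ g) x) (a b : (EuclideanSpace ℝ (Fin 2))) :
    fderiv ℝ (fun y => fderiv ℝ g y a) x b = fderiv ℝ (fderiv ℝ g) x b a := by
  rw [fderiv_clm_apply hg (differentiableAt_const a)]
  simp

/-- Differentiating `div v = 0`: `(D²v(x) w e₀)₀ + (D²v(x) w e₁)₁ = 0` for every `w`. [folklore] -/
theorem fderiv_fderiv_trace_eq_zero₂ {v : (EuclideanSpace ℝ (Fin 2)) → (EuclideanSpace ℝ (Fin 2))} (hv : ContDiff ℝ 2 v)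
    (hdiv : VectorCalculus.IsDivFree v) (x w : (EuclideanSpace ℝ (Fin 2))) :
    fderiv ℝ (fderiv ℝ v) x w (EuclideanSpace.basisFun (Fin 2) ℝ 0) 0 + fderiv ℝ (fderiv ℝ v) x w (EuclideanSpace.basisFun (Fin 2) ℝ 1) 1 = 0 := by
  have h1 : ContDiff ℝ 1 (fderiv ℝ v) := hv.fderiv_right one_add_one_eq_two.le
  set S := fderiv ℝ (fderiv ℝ v) x with hS
  have hD2 : HasFDerivAt (fderiv ℝ v) S x := (h1.differentiable one_ne_zero x).hasFDerivAt
  let Ldiv : ((EuclideanSpace ℝ (Fin 2)) →L[ℝ] (EuclideanSpace ℝ (Fin 2))) →L[ℝ] ℝ :=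
    (EuclideanSpace.proj 0).comp (ContinuousLinearMap.apply ℝ (EuclideanSpace ℝ (Fin 2)) (EuclideanSpace.basisFun (Fin 2) ℝ 0)) +
      (EuclideanSpace.proj 1).comp (ContinuousLinearMap.apply ℝ (EuclideanSpace ℝ (Fin 2)) (EuclideanSpace.basisFun (Fin 2) ℝ 1))
  have hLdiv : ∀ T : (EuclideanSpace ℝ (Fin 2)) →L[ℝ] (EuclideanSpace ℝ (Fin 2)), Ldiv T = T (EuclideanSpace.basisFun (Fin 2) ℝ 0) 0 + T (EuclideanSpace.basisFun (Fin 2) ℝ 1) 1 := fun T => rfl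
  have hdiv' : (fun y => Ldiv (fderiv ℝ v y)) = fun _ => 0 := by
    funext y
    rw [hLdiv, ← divergence_eq_two₂, hdiv y]
  have hDdiv : fderiv ℝ (fun y => Ldiv (fderiv ℝ v y)) x = Ldiv.comp S :=
    (Ldiv.hasFDerivAt.comp x hD2).fderiv
  rw [hdiv'] at hDdiv
  simp only [fderiv_fun_const, Pi.zero_apply] at hDdiv
  have := DFunLike.congr_fun hDdiv w
  rw [zero_apply, ContinuousLinearMap.comp_apply, hLdiv] at this
  exact this.symm

/-- The derivative of the planar vorticity: `Dω(x) w = (D²v(x) w e₀)₁ − (D²v(x) w e₁)₀`,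
`ω = curl2 v`, for `v ∈ C²`. [folklore] -/
theorem fderiv_curl2_apply₂ {v : (EuclideanSpace ℝ (Fin 2)) → (EuclideanSpace ℝ (Fin 2))} (hv : ContDiff ℝ 2 v) (x w : (EuclideanSpace ℝ (Fin 2))) :
    fderiv ℝ (curl2 v) x w =
      fderiv ℝ (fderiv ℝ v) x w (EuclideanSpace.basisFun (Fin 2) ℝ 0) 1 - fderiv ℝ (fderiv ℝ v) x w (EuclideanSpace.basisFun (Fin 2) ℝ 1) 0 := by
  have h1 : ContDiff ℝ 1 (fderiv ℝ v) := hv.fderiv_right one_add_one_eq_two.le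
  have hD2 : HasFDerivAt (fderiv ℝ v) (fderiv ℝ (fderiv ℝ v) x) x :=
    (h1.differentiable one_ne_zero x).hasFDerivAt
  rw [curl2_eq_comp, (curl2CLM.hasFDerivAt.comp x hD2).fderiv, ContinuousLinearMap.comp_apply,
    curl2CLM_apply, EuclideanSpace.basisFun_apply, EuclideanSpace.basisFun_apply]

/-- The planar vorticity of a `C²` field is `C¹`. [folklore] -/
theorem contDiff_one_curl2₂ {v : (EuclideanSpace ℝ (Fin 2)) → (EuclideanSpace ℝ (Fin 2))} (hv : ContDiff ℝ 2 v) : ContDiff ℝ 1 (curl2 v) := by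
  rw [curl2_eq_comp]
  exact curl2CLM.contDiff.comp (hv.fderiv_right one_add_one_eq_two.le)

/-- **`Δv = ∇⊥ω` for a divergence-free planar field** (`v ∈ C²`, `ω = curl2 v`): in coordinates
`(Δv)₀ = −∂₁ω`, `(Δv)₁ = ∂₀ω` (the planar identity `Δ = ∇ div − ∇⊥ curl2`). [folklore] -/
theorem laplacian_apply_eq_curl2₂ {v : (EuclideanSpace ℝ (Fin 2)) → (EuclideanSpace ℝ (Fin 2))} (hv : ContDiff ℝ 2 v)
    (hdiv : VectorCalculus.IsDivFree v) (x : (EuclideanSpace ℝ (Fin 2))) :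
    (Δ v) x 0 = -fderiv ℝ (curl2 v) x (EuclideanSpace.basisFun (Fin 2) ℝ 1) ∧ (Δ v) x 1 = fderiv ℝ (curl2 v) x (EuclideanSpace.basisFun (Fin 2) ℝ 0) := by
  have h1 : ContDiff ℝ 1 (fderiv ℝ v) := hv.fderiv_right one_add_one_eq_two.le
  set S := fderiv ℝ (fderiv ℝ v) x with hS
  have hsymm : IsSymmSndFDerivAt ℝ v x := hv.contDiffAt.isSymmSndFDerivAt (by simp)
  have h01 : S (EuclideanSpace.basisFun (Fin 2) ℝ 0) (EuclideanSpace.basisFun (Fin 2) ℝ 1) = S (EuclideanSpace.basisFun (Fin 2) ℝ 1) (EuclideanSpace.basisFun (Fin 2) ℝ 0) := hsymm (EuclideanSpace.basisFun (Fin 2) ℝ 0) (EuclideanSpace.basisFun (Fin 2) ℝ 1)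
  have hΔ : Δ v x = S (EuclideanSpace.basisFun (Fin 2) ℝ 0) (EuclideanSpace.basisFun (Fin 2) ℝ 0) + S (EuclideanSpace.basisFun (Fin 2) ℝ 1) (EuclideanSpace.basisFun (Fin 2) ℝ 1) := by
    rw [laplacian_eq_sum_fderiv_fderiv (EuclideanSpace.basisFun (Fin 2) ℝ) hv x, Fin.sum_univ_two,
      fderiv_apply_const_apply₂ (h1.differentiable one_ne_zero x),
      fderiv_apply_const_apply₂ (h1.differentiable one_ne_zero x)]
  have hd0 := fderiv_fderiv_trace_eq_zero₂ hv hdiv x (EuclideanSpace.basisFun (Fin 2) ℝ 0)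
  have hd1 := fderiv_fderiv_trace_eq_zero₂ hv hdiv x (EuclideanSpace.basisFun (Fin 2) ℝ 1)
  rw [fderiv_curl2_apply₂ hv, fderiv_curl2_apply₂ hv, hΔ, ← hS]
  rw [← hS] at hd0 hd1
  refine ⟨?_, ?_⟩
  · simp only [PiLp.add_apply]
    rw [h01] at hd0
    linarith
  · simp only [PiLp.add_apply]
    rw [← h01] at hd1
    linarith

/-- `⟪Δv, a⟫ = ∂₀ω ⟪a, e₁⟫ − ∂₁ω ⟪a, e₀⟫` for a divergence-free planar `v ∈ C²`. [folklore] -/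
theorem inner_laplacian_eq_curl2₂ {v : (EuclideanSpace ℝ (Fin 2)) → (EuclideanSpace ℝ (Fin 2))} (hv : ContDiff ℝ 2 v)
    (hdiv : VectorCalculus.IsDivFree v) (x a : (EuclideanSpace ℝ (Fin 2))) :
    ⟪(Δ v) x, a⟫ = fderiv ℝ (curl2 v) x (EuclideanSpace.basisFun (Fin 2) ℝ 0) * a 1 - fderiv ℝ (curl2 v) x (EuclideanSpace.basisFun (Fin 2) ℝ 1) * a 0 := by
  obtain ⟨h0, h1⟩ := laplacian_apply_eq_curl2₂ hv hdiv x
  rw [inner_eq_two₂, h0, h1]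
  ring

/-- Derivative of the self-convection term: `∂ₕ((v·∇)v)(x) = (v·∇)(∂ₕv)(x) + Dv(x)(Dv(x) h)` for
`v ∈ C²` (symmetry of second derivatives). [folklore] -/
theorem fderiv_convect_self_apply₂ {v : (EuclideanSpace ℝ (Fin 2)) → (EuclideanSpace ℝ (Fin 2))} (hv : ContDiff ℝ 2 v) (x h : (EuclideanSpace ℝ (Fin 2))) :
    fderiv ℝ (convect v v) x h =
      convect v (fun y => fderiv ℝ v y h) x + fderiv ℝ v x (fderiv ℝ v x h) := by
  have hd1 : DifferentiableAt ℝ (fderiv ℝ v) x :=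
    ((hv.fderiv_right (m := 1) (by norm_num)).differentiable one_ne_zero) x
  have hd0 : DifferentiableAt ℝ v x := (hv.differentiable (by norm_num)) x
  have hw : convect v v = fun y => (fderiv ℝ v y) (v y) := rfl
  have hsymm : IsSymmSndFDerivAt ℝ v x := hv.contDiffAt.isSymmSndFDerivAt (by simp)
  rw [hw, fderiv_clm_apply hd1 hd0]
  simp only [_root_.add_apply, ContinuousLinearMap.comp_apply,
    ContinuousLinearMap.flip_apply]
  rw [add_comm]
  congr 1
  rw [convect, fderiv_apply_const_apply₂ hd1]
  exact hsymm h (v x)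

/-! ### Integration by parts on the plane -/

/-- **`∫ Σᵢ ⟪∂ᵢv, ∂ᵢw⟫ = −∫ ⟪Δv, w⟫` on `(EuclideanSpace ℝ (Fin 2))`** for `v ∈ C²`, `w ∈ C¹` with `∂ᵢ∂ᵢv · w`,
`∂ᵢv · ∂ᵢw`, `∂ᵢv · w ∈ L¹` (coordinatewise integration by parts; planar twin of the tree's
`integral_sum_inner_fderiv_fderiv_eq_neg_integral_inner_laplacian`). [folklore] -/
theorem green_sum_inner_fderiv₂ {v w : (EuclideanSpace ℝ (Fin 2)) → (EuclideanSpace ℝ (Fin 2))} (hv : ContDiff ℝ 2 v) (hw : ContDiff ℝ 1 w)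
    (h1 : ∀ i, Integrable (fun x => ⟪fderiv ℝ (fun y => fderiv ℝ v y (EuclideanSpace.basisFun (Fin 2) ℝ i)) x (EuclideanSpace.basisFun (Fin 2) ℝ i), w x⟫) volume)
    (h2 : ∀ i, Integrable (fun x => ⟪fderiv ℝ v x (EuclideanSpace.basisFun (Fin 2) ℝ i), fderiv ℝ w x (EuclideanSpace.basisFun (Fin 2) ℝ i)⟫) volume)
    (h3 : ∀ i, Integrable (fun x => ⟪fderiv ℝ v x (EuclideanSpace.basisFun (Fin 2) ℝ i), w x⟫) volume) :
    ∫ x, ∑ i, ⟪fderiv ℝ v x (EuclideanSpace.basisFun (Fin 2) ℝ i), fderiv ℝ w x (EuclideanSpace.basisFun (Fin 2) ℝ i)⟫ = - ∫ x, ⟪(Δ v) x, w x⟫ := by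
  have hdf : ∀ i, Differentiable ℝ (fun y => fderiv ℝ v y (EuclideanSpace.basisFun (Fin 2) ℝ i)) := fun i =>
    ((hv.fderiv_right (m := 1) (by norm_num)).clm_apply contDiff_const).differentiable one_ne_zero
  have hdw : Differentiable ℝ w := hw.differentiable one_ne_zero
  have hIBP : ∀ i, ∫ x, ⟪fderiv ℝ v x (EuclideanSpace.basisFun (Fin 2) ℝ i), fderiv ℝ w x (EuclideanSpace.basisFun (Fin 2) ℝ i)⟫ =
      - ∫ x, ⟪fderiv ℝ (fun y => fderiv ℝ v y (EuclideanSpace.basisFun (Fin 2) ℝ i)) x (EuclideanSpace.basisFun (Fin 2) ℝ i), w x⟫ := by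
    intro i
    have := integral_bilinear_fderiv_right_eq_neg_left_of_integrable (μ := volume)
      (B := (innerSL ℝ : (EuclideanSpace ℝ (Fin 2)) →L[ℝ] (EuclideanSpace ℝ (Fin 2)) →L[ℝ] ℝ))
      (f := fun y => fderiv ℝ v y (EuclideanSpace.basisFun (Fin 2) ℝ i)) (g := w) (v := EuclideanSpace.basisFun (Fin 2) ℝ i) (by exact h1 i) (by exact h2 i)
      (by exact h3 i) (fun x _ => hdf i x) (fun x _ => hdw x)
    exact this
  rw [integral_finsetSum _ fun i _ => h2 i]
  simp_rw [hIBP]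
  rw [Finset.sum_neg_distrib, ← integral_finsetSum _ fun i _ => h1 i]
  congr 1
  refine integral_congr_ae (Eventually.of_forall fun x => ?_)
  simp only
  rw [laplacian_eq_sum_fderiv_fderiv (EuclideanSpace.basisFun (Fin 2) ℝ) hv x, sum_inner]

/-- Integrability on the plane from a decay bound `‖g x‖ ≤ C (1 + ‖x‖)^{-r}`, `r > 2`. [folklore] -/
theorem integrable_of_le_decay₂ {G : Type*} [NormedAddCommGroup G] {g : (EuclideanSpace ℝ (Fin 2)) → G}
    (hg : Continuous g) {C r : ℝ} (hr : 2 < r) (h : ∀ x, ‖g x‖ ≤ C * (1 + ‖x‖) ^ (-r)) :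
    Integrable g volume := by
  refine integrable_of_norm_le_rpow_neg (μ := volume) hg ?_ h
  simpa [finrank_euclideanSpace_fin] using hr

end TwoDimActionBound

end Summit.NavierStokesRegularity.NavierStokesRegularity.Theorems
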